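import Literature.MathematicalPhysics.QuantumFieldTheory.Balaban1983to89.Node00.Record12LiveSelector
import Literature.MathematicalPhysics.QuantumFieldTheory.Balaban1983to89.Node00.Record12PresentSlots

/-!
# NODE 00 (YM-PLAN Track A) — STAGE 12: `SlotsNondegenerate` AT THE LIVE RE-PIN **UP TO THE TORUS IS A THEOREM** from the displayed `Provisos₁₀` alone
# (junction K0a `Record12LiveSelector` ∘ K0b `Record12PresentSlots`; director-ym LINES №118 (d) ∕ №119)

Cell `pub-ymgap`, seat `pub-ymgap-node00-def-K0a` (g2).  [III] = [Balaban1988Convergent], [IV] = [Balaban1989LargeFieldI].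

WHAT IS JOINED.  `Record12LiveSelector` (this seat, p477230): at the live re-pin `θ.liveRepin` of ANY Stage-12 parameter, 12b's `SlotsNondegenerate` ⟺ «at every
level `k + 1` of every run that has sequences, SOME sequence is LIVE» (`Stage12Params.slotsNondegenerate_liveRepin_iff`), where LIVE = the post-𝐑 slot at the
identity selector is non-zero somewhere (`LiveSeq`, keyed on def-R's instance-free `rstepSlot … id`).  `Record12PresentSlots` (seat K0b, p476033 ∕ p476260):
**at every level `k + 1 ≤ K` of every run SOME sequence has its 𝐓-image slot AND its own-`Z′` fibre integral non-zero at a common configuration — from `Provisos₁₀`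
ALONE** (`exists_live_slotsTOfRecord_succ_rterm`: mass conservation of the tower + the disintegration face + Fubini over a fibre); and the located reach of the
UNGUARDED predicate beyond the torus (`nonempty_seqOfRecord`, LOCATED-R4; director №118: 12b v2.3 guards the def by the level, def-T's pen).

WHAT THIS FILE PROVES (theorems only).
* §1 THE BRIDGE between the two liveness currencies, for ANY `DecidableEq (PBond …)` instance the fibre integral may carry (explicit binder `iP`, def-R TS-8;
  `fibreIntegral_instIrrel`): `liveSeq_of_ne_zero` (slot `≠ 0` ∧ own fibre integral `≠ 0` at `V` ⇒ LIVE) and `exists_ne_zero_of_liveSeq` (converse).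
* §2 **`Stage12Params.exists_liveSeq_liveRepin`**: at the live re-pin of any `θ` whose re-pinned Stage-9 tuple carries `Provisos₁₀`, every level `k + 1 ≤ K` of
  every run has a live sequence (K0b's theorem, by name, through §1); hence **`Stage12Params.slotsOfRecord_liveRepin_ne_zero_of_le`** — 12b's predicate READ UP TO THE
  TORUS (`k ≤ p.K`) HOLDS at the live re-pin, NO residual hypothesis beyond `Provisos₁₀` (director №118 (d): the guarded form; once 12b v2.3 guards the def body by
  the level — v2.3, LANDED — this IS **`Stage12Params.slotsNondegenerate_liveRepin (hP)`**: `SlotsNondegenerate` at the live re-pin from `Provisos₁₀` ALONE;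
  v1.1 of this file replaces the v1 «beyond the torus» forms of the unguarded predicate, which 12b v2.3 made void).
* §3 AT THE RE-PINNED K0′ WITNESS `θ₀ˡⁱᵛᵉ = theta12LiveOfRecord F N ζ Rz Zt`: the same by name (`exists_liveSeq_theta12LiveOfRecord`,
  `slotsOfRecord_theta12LiveOfRecord_ne_zero_of_le`, **`slotsNondegenerate_theta12LiveOfRecord (hP)`**), and **`exists_k0prime_of_theta12Live_of_provisos₁₂`** — the
  K0′ body for `F` at `N = 2` ⟸ `Provisos₁₂` AT `θ₀ˡⁱᵛᵉ` ALONE (= rows P1–P3 ∕ P6 ∕ P7 ∕ P11 of the component table; everything else at the witness is a theorem).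

* §4 (v1.2, plan ANSWER №122 ∕ director-ym LINE №125 (4)) **RUNG A OF THE K0′ SKELETON OF RECORD v3 BY NAME**: at the live re-pin of ANY admissible
  Stage-12 parameter, `Provisos₁₀` of the re-pinned Stage-9 tuple ALONE makes that tuple a witness of the skeleton's `Base12` body — admissible, with the
  Stage-10 provisos, `γ < 1`, `0 < A₁`, and EVERY Stage-12 tuple over it slot-non-degenerate (`Stage12Params.rungA_liveRepin`, `…exists_rungA_liveRepin`; K0b's
  `slotsNondegenerate_of_extension`); at `θ₀ˡⁱᵛᵉ` (`rungA_theta12LiveOfRecord`, `exists_rungA_theta12LiveOfRecord`) and, at `N = 2` and K0b's residuals, the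
  body of `Base12 F` VERBATIM (**`base12_theta12Live_of_provisos₁₀ F (hP)`**): `stub_base12` ⟸ `Provisos₁₀ θ₀ˡⁱᵛᵉ` — whose three located rows (H-U) ∕ P6 ∕ P7 are
  seat K0c's `provisos₁₀_theta12LiveOfRecord_of_localBg` (`Node00/Record12MeasurabilityAtLiveRecord`, not imported here: it imports this file).

HONEST FRAMING.  Bookkeeping over K0b's and this seat's landed theorems + one subsingleton transport; `Provisos₁₀`∕`Provisos₁₂` at the re-pinned witness are
HYPOTHESES (the open rows), nothing of Bałaban is asserted, no node or crux is discharged; counts unmoved (typed 28∕28 · discharged 5∕28); one finite 𝕋⁴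
programme at fixed ε — NOT continuum ∕ OS ∕ mass gap ∕ Clay.  No `sorry`, no `axiom`, no `def`, no `instance`, no `notation`.
-/

noncomputable section

open MeasureTheory
open scoped BigOperators Matrix.Norms.L2Operator

namespace Literature.MathematicalPhysics.QuantumFieldTheory.Balaban1983to89.Node00

open T4Continuum B14.Eq218Concrete B15RopTotal FlowStep FlowStepRuns
open B15.BasicStep (fibreIntegral)

/-! ## §1. The bridge between the liveness currencies (any `DecidableEq (PBond …)` instance) -/

section Bridge

/-- b01's fibre integral does not depend on the `DecidableEq (PBond P j)` instance it reads (a subsingleton; def-R TS-8 transport).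
[cite: Balaban1989LargeFieldI, (0.3) p.176 (bookkeeping)] -/
theorem fibreIntegral_instIrrel {P : Params} {j : ℕ} {G : Type*} [GaugeGroup G] [MeasurableSpace G] [HaarData G] (i₁ i₂ : DecidableEq (PBond P j))
    (s : Finset (PBond P j)) (f : Density P j G) : @fibreIntegral P j G _ _ _ i₁ s f = @fibreIntegral P j G _ _ _ i₂ s f := by
  cases Subsingleton.elim i₁ i₂
  rfl

variable (F : T4Family) (N : ℕ) [NeZero N] {ν : Stage7Numerics} {τ : TowerNumerics} {p : B12.RunParams} {g : ℕ → ℝ} {k : ℕ}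

/-- **LIVE from the slot-and-own-fibre-integral currency** (seat K0b's `exists_live_slotsTOfRecord_succ_rterm`), whatever instance the fibre integral carries:
`f(s)(V) ≠ 0` and `∫⌈_{Z′(s)} χ_k(s)·f(s) (V) ≠ 0` give `LiveSeq … f s` (the post-𝐑 slot at the identity selector is `f(s)(V) · ∫⌈ ∕ ∫⌈`, `rstepOfSel_id_TexpA`).
[cite: Balaban1989LargeFieldI, (0.3) p.176] -/
theorem liveSeq_of_ne_zero (iP : DecidableEq (PBond (F.P p.K) k)) {f : TexpASlot F N ν τ.M p g k} {s : SeqOfRecord F ν τ.M g p.K k}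
    {V : GaugeField (F.P p.K) k (SU N)} (hf : f s V ≠ 0)
    (hI : @fibreIntegral (F.P p.K) k (SU N) _ _ _ iP (fibOfSeq F ν τ p g k s) (rterm (sliceOfRecord F N ν τ.M p g k f) s) V ≠ 0) :
    LiveSeq F N ν τ p g k f s := by
  refine ⟨V, ?_⟩
  unfold rstepSlot
  refine ne_of_eq_of_ne (rstepOfSel_id_TexpA N _ (sliceOfRecord F N ν τ.M p g k f) (fibOfSeq F ν τ p g k) s V) ?_
  refine mul_ne_zero hf ?_
  unfold rratio
  rw [fibreIntegral_instIrrel _ iP]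
  exact div_ne_zero hI hI

/-- **Conversely, a LIVE sequence has, at some configuration, non-zero slot and non-zero own fibre integral** (in any instance's currency).
[cite: Balaban1989LargeFieldI, (0.3) p.176] -/
theorem exists_ne_zero_of_liveSeq (iP : DecidableEq (PBond (F.P p.K) k)) {f : TexpASlot F N ν τ.M p g k} {s : SeqOfRecord F ν τ.M g p.K k}
    (h : LiveSeq F N ν τ p g k f s) :
    ∃ V : GaugeField (F.P p.K) k (SU N), f s V ≠ 0 ∧
      @fibreIntegral (F.P p.K) k (SU N) _ _ _ iP (fibOfSeq F ν τ p g k s) (rterm (sliceOfRecord F N ν τ.M p g k f) s) V ≠ 0 := by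
  obtain ⟨V, hV⟩ := h
  refine ⟨V, ?_⟩
  unfold rstepSlot at hV
  have h2 := ne_of_eq_of_ne (rstepOfSel_id_TexpA N _ (sliceOfRecord F N ν τ.M p g k f) (fibOfSeq F ν τ p g k) s V).symm hV
  obtain ⟨hf, hρ⟩ := mul_ne_zero_iff.mp h2
  refine ⟨hf, ?_⟩
  unfold rratio at hρ
  rw [fibreIntegral_instIrrel _ iP] at hρ
  intro h0
  rw [h0, div_zero] at hρ
  exact hρ rfl

end Bridge

/-! ## §2. At the live re-pin of a Stage-12 parameter under `Provisos₁₀`: live sequences at every level up to the torus; the guarded predicate HOLDS -/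

section Repin

variable (F : T4Family) (N : ℕ) [NeZero N] (θ : Stage12Params F N)

/-- **LIVE SEQUENCES EXIST AT EVERY LEVEL `k + 1 ≤ K` OF EVERY RUN at the live re-pin** of a parameter whose re-pinned Stage-9 tuple carries `Provisos₁₀`
(seat K0b's `exists_live_slotsTOfRecord_succ_rterm` — mass conservation + disintegration face + fibre Fubini — through the bridge of §1).
[cite: Balaban1988Convergent, (3.1) p.264, (3.22) p.269, (3.24)–(3.25) p.270; Balaban1989LargeFieldI, (0.3)–(0.4) p.176] -/
theorem Stage12Params.exists_liveSeq_liveRepin (hP : (θ.liveRepin F N).toStage9Params.Provisos₁₀) (p : B12.RunParams) (k : ℕ) (hk : k < p.K) :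
    ∃ s, LiveSeq F N θ.ν θ.τ9 p (gOfRecord₁₀ F N θ.toStage9Params p) (k + 1)
      (slotsTOfRecord F N θ.ν θ.τ9 (EOfRecord₁₀ F N θ.toStage9Params) (wOfRecord₉ F N θ.toStage9Params) (θ.liveRepin F N).ppSel p
        (gOfRecord₁₀ F N θ.toStage9Params p) (k + 1)) s := by
  obtain ⟨s, V, hT, hI⟩ := exists_live_slotsTOfRecord_succ_rterm F N (θ.liveRepin F N).toStage9Params p hP k hk
  exact ⟨s, liveSeq_of_ne_zero F N _ hT hI⟩

/-- **★ 12b's `SlotsNondegenerate` READ UP TO THE TORUS HOLDS AT THE LIVE RE-PIN, from `Provisos₁₀` alone**: for every run `p`, every level `k ≤ p.K` and every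
sequence in the range of the live selector, the post-𝐑 slot of record is not the zero density (level `0`: `ρ₀ > 0`; level `k + 1 ≤ K`: a range point of the live
selector is a live fixed point, and live points exist by `exists_liveSeq_liveRepin`).  The guarded form of director-ym №118 (d): once 12b v2.3 guards the def body by
the level, this IS `θ.liveRepin.SlotsNondegenerate`. [cite: Balaban1988Convergent, (3.22) p.269, (3.24) p.270; Balaban1989LargeFieldI, (0.3) p.176] -/
theorem Stage12Params.slotsOfRecord_liveRepin_ne_zero_of_le (hP : (θ.liveRepin F N).toStage9Params.Provisos₁₀) (p : B12.RunParams) (k : ℕ)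
    (hk : k ≤ p.K) (s : SeqOfRecord F θ.ν θ.τ9.M (gOfRecord₁₀ F N θ.toStage9Params p) p.K k)
    (hs : s ∈ Set.range ((θ.liveRepin F N).ppSel p (gOfRecord₁₀ F N θ.toStage9Params p) k)) :
    slotsOfRecord F N θ.ν θ.τ9 (EOfRecord₁₀ F N θ.toStage9Params) (wOfRecord₉ F N θ.toStage9Params) (θ.liveRepin F N).ppSel p
      (gOfRecord₁₀ F N θ.toStage9Params p) k s ≠ 0 := by
  revert s
  show ∀ s : SeqOfRecord F θ.ν θ.τ9.M (gOfRecord₁₀ F N θ.toStage9Params p) p.K k,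
      s ∈ Set.range (ppSelLiveOfRecord F N θ.ν θ.τ9 (EOfRecord₁₀ F N θ.toStage9Params) (wOfRecord₉ F N θ.toStage9Params) p
        (gOfRecord₁₀ F N θ.toStage9Params p) k) →
      slotsOfRecord F N θ.ν θ.τ9 (EOfRecord₁₀ F N θ.toStage9Params) (wOfRecord₉ F N θ.toStage9Params)
        (ppSelLiveOfRecord F N θ.ν θ.τ9 (EOfRecord₁₀ F N θ.toStage9Params) (wOfRecord₉ F N θ.toStage9Params)) p
        (gOfRecord₁₀ F N θ.toStage9Params p) k s ≠ 0
  cases k with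
  | zero => exact fun s _ => slotsOfRecord_zero_ne_zero F N θ.ν θ.τ9 _ _ _ p _ s
  | succ k =>
    exact (slotsOfRecord_ppSelLive_succ_nondegenerate_iff F N θ.ν θ.τ9 _ _ p _ k).mpr
      (fun _ => Stage12Params.exists_liveSeq_liveRepin F N θ hP p k (Nat.lt_of_succ_le hk))

/-- **★ `SlotsNondegenerate` HOLDS AT THE LIVE RE-PIN from `Provisos₁₀` ALONE** (12b v2.3: the predicate is guarded by the level `k ≤ p.K`, director-ym LINE №118;
up to the torus live sequences exist by `exists_liveSeq_liveRepin`).  Row P12 of the K0′ component table at the re-pinned witness is thereby reduced to NOTHING beyond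
rung A's `Provisos₁₀`. [cite: Balaban1988Convergent, (3.22) p.269, (3.24) p.270; Balaban1989LargeFieldI, (0.3)–(0.4) p.176] -/
theorem Stage12Params.slotsNondegenerate_liveRepin (hP : (θ.liveRepin F N).toStage9Params.Provisos₁₀) : (θ.liveRepin F N).SlotsNondegenerate :=
  (Stage12Params.slotsNondegenerate_liveRepin_iff F N θ).mpr fun p k hk _ =>
    Stage12Params.exists_liveSeq_liveRepin F N θ hP p k (Nat.lt_of_succ_le hk)

end Repin

/-! ## §3. At the re-pinned K0′ witness `θ₀ˡⁱᵛᵉ = theta12LiveOfRecord F N ζ Rz Zt` -/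

section Theta

variable (F : T4Family) (N : ℕ) [NeZero N]
variable (ζ : ZetaOfRecord F N numerics7OfRecord₁₂ 1) (Rz : (K : ℕ) → Sect2.Residual (F.P K) (MatA N)) (Zt : (K : ℕ) → TkResidualW F N (FluctV N) K)

/-- **Live sequences at every level up to the torus at `θ₀ˡⁱᵛᵉ`**, given `Provisos₁₀` of its Stage-9 tuple (rung A's open rows at the re-pinned witness).
[cite: Balaban1988Convergent, (3.1) p.264, (3.22) p.269, (3.24)–(3.25) p.270; Balaban1989LargeFieldI, (0.3)–(0.4) p.176] -/
theorem exists_liveSeq_theta12LiveOfRecord (hP : (theta12LiveOfRecord F N ζ Rz Zt).toStage9Params.Provisos₁₀) (p : B12.RunParams) (k : ℕ)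
    (hk : k < p.K) :
    ∃ s, LiveSeq F N numerics7OfRecord₁₂ towerNumericsOfRecord₁₂ p (gOfRecord₁₀ F N (theta12OfRecord F N ζ Rz Zt).toStage9Params p) (k + 1)
      (slotsTOfRecord F N numerics7OfRecord₁₂ towerNumericsOfRecord₁₂ (EOfRecord₁₀ F N (theta12OfRecord F N ζ Rz Zt).toStage9Params)
        (wOfRecord₉ F N (theta12OfRecord F N ζ Rz Zt).toStage9Params) (theta12LiveOfRecord F N ζ Rz Zt).ppSel p
        (gOfRecord₁₀ F N (theta12OfRecord F N ζ Rz Zt).toStage9Params p) (k + 1)) s :=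
  Stage12Params.exists_liveSeq_liveRepin F N (theta12OfRecord F N ζ Rz Zt) hP p k hk

/-- **★ ROW P12 AT `θ₀ˡⁱᵛᵉ` UP TO THE TORUS, GIVEN `Provisos₁₀` — NO OTHER RESIDUAL**: every post-𝐑 slot of record at a sequence in the live selector's range, at
every level `k ≤ p.K` of every run, is not the zero density. [cite: Balaban1988Convergent, (3.22) p.269, (3.24) p.270; Balaban1989LargeFieldI, (0.3) p.176] -/
theorem slotsOfRecord_theta12LiveOfRecord_ne_zero_of_le (hP : (theta12LiveOfRecord F N ζ Rz Zt).toStage9Params.Provisos₁₀) (p : B12.RunParams)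
    (k : ℕ) (hk : k ≤ p.K)
    (s : SeqOfRecord F numerics7OfRecord₁₂ 1 (gOfRecord₁₀ F N (theta12OfRecord F N ζ Rz Zt).toStage9Params p) p.K k)
    (hs : s ∈ Set.range ((theta12LiveOfRecord F N ζ Rz Zt).ppSel p (gOfRecord₁₀ F N (theta12OfRecord F N ζ Rz Zt).toStage9Params p) k)) :
    slotsOfRecord F N numerics7OfRecord₁₂ towerNumericsOfRecord₁₂ (EOfRecord₁₀ F N (theta12OfRecord F N ζ Rz Zt).toStage9Params)
      (wOfRecord₉ F N (theta12OfRecord F N ζ Rz Zt).toStage9Params) (theta12LiveOfRecord F N ζ Rz Zt).ppSel p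
      (gOfRecord₁₀ F N (theta12OfRecord F N ζ Rz Zt).toStage9Params p) k s ≠ 0 :=
  Stage12Params.slotsOfRecord_liveRepin_ne_zero_of_le F N (theta12OfRecord F N ζ Rz Zt) hP p k hk s hs

/-- **★ `SlotsNondegenerate` AT `θ₀ˡⁱᵛᵉ` from `Provisos₁₀` of its Stage-9 tuple alone.** [cite: Balaban1988Convergent, (3.22) p.269, (3.24) p.270; Balaban1989LargeFieldI, (0.3)–(0.4) p.176] -/
theorem slotsNondegenerate_theta12LiveOfRecord (hP : (theta12LiveOfRecord F N ζ Rz Zt).toStage9Params.Provisos₁₀) :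
    (theta12LiveOfRecord F N ζ Rz Zt).SlotsNondegenerate :=
  Stage12Params.slotsNondegenerate_liveRepin F N (theta12OfRecord F N ζ Rz Zt) hP

/-- **★ THE K0′ BODY FOR `F` AT `N = 2` FROM THE RE-PINNED WITNESS ⟸ `Provisos₁₂` AT IT, ALONE**: GIVEN the provisos of record at `θ₀ˡⁱᵛᵉ` (at K0b's residuals of
record) — their `base` field IS `Provisos₁₀` of the re-pinned tuple, which yields `SlotsNondegenerate`; `ZtUnity` and `Admissible` are theorems there — the
re-pinned parameter inhabits the text of `Record12Inhabited` for `F`, verbatim.  What remains of K0′ at this witness is EXACTLY `Provisos₁₂` (rows P1–P3 ∕ P6 ∕ P7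
of rung A and the `bg` row P11). [cite: Balaban1988Convergent, Thm 1 p.262, (3.16)–(3.22) pp.268–269; Balaban1989LargeFieldI, (0.3)–(0.4) p.176 (bookkeeping)] -/
theorem exists_k0prime_of_theta12Live_of_provisos₁₂ (F : T4Family)
    (h : (theta12LiveOfRecord F 2 (zeta316OfRecord F 2 numerics7OfRecord₁₂ 1 1) (RzOfRecord F 2) (ZtOfRecord F 2)).Provisos₁₂ F 2) :
    ∃ θ : Stage12Params F 2, θ.Provisos₁₂ F 2 ∧ (θ.ZtUnity F 2 ∧ θ.SlotsNondegenerate) ∧ θ.Admissible F 2 :=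
  ⟨_, h, ⟨ztUnity_theta12LiveOfRecord F 2, slotsNondegenerate_theta12LiveOfRecord F 2 _ _ _ h.base⟩, admissible_theta12LiveOfRecord F 2 _ _ _⟩

end Theta

/-! ## §4. RUNG A OF THE K0′ SKELETON OF RECORD (v3) BY NAME — the non-degenerate Stage-9∕10 base from `Provisos₁₀` at the live re-pin (v1.2) -/

section RungA

variable (F : T4Family) (N : ℕ) [NeZero N] (θ : Stage12Params F N)

/-- **RUNG A AT THE LIVE RE-PIN OF AN ADMISSIBLE STAGE-12 PARAMETER, READ AT ITS STAGE-9 TUPLE, from `Provisos₁₀` there alone**: the re-pinned Stage-9 tuple is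
admissible (`Admissible.toStage9`, selector-blind), carries the Stage-10 provisos (the hypothesis), has `γ < 1` and `0 < A₁` (the Stage-12 signs `Pos₁₂`), and EVERY
Stage-12 tuple over it is slot-non-degenerate (§2 `slotsNondegenerate_liveRepin` at the re-pin itself, carried to any other extension by K0b's
`slotsNondegenerate_of_extension` — 12b's predicate reads the Stage-9 part only).  The five conjuncts of the skeleton's `Base12` (v3 :62, `SlotsNondegenerateAt`
unfolded) AT THE NAMED TUPLE. [cite: Balaban1987RG1, (0.21) p.256, (1.12) p.262; Balaban1988Convergent, (2.10) p.256, (3.4) p.265, (3.22) p.269, (3.24) p.270; Balaban1989LargeFieldI, (0.3)–(0.4) p.176 (bookkeeping)] -/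
theorem Stage12Params.rungA_liveRepin (hθ : θ.Admissible F N) (hP : (θ.liveRepin F N).toStage9Params.Provisos₁₀) :
    (θ.liveRepin F N).toStage9Params.Admissible ∧ (θ.liveRepin F N).toStage9Params.Provisos₁₀ ∧ (θ.liveRepin F N).toStage9Params.γ < 1 ∧
      0 < (θ.liveRepin F N).toStage9Params.A₁ ∧
        ∀ θ₁ : Stage12Params F N, θ₁.toStage9Params = (θ.liveRepin F N).toStage9Params → θ₁.SlotsNondegenerate :=
  ⟨hθ.liveRepin.toStage9, hP, hθ.liveRepin.pos₁₂.2.2.2.2, hθ.liveRepin.pos₁₂.2.1,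
    fun _ h₁ => slotsNondegenerate_of_extension rfl h₁ (Stage12Params.slotsNondegenerate_liveRepin F N θ hP)⟩

/-- **RUNG A AT THE LIVE RE-PIN, EXISTENTIAL FORM** — the body of the skeleton's `Base12` (v3 :62) at every `N`: SOME admissible Stage-9 tuple with the Stage-10
provisos, `γ < 1`, `0 < A₁`, over which every Stage-12 tuple is slot-non-degenerate; witnessed by the re-pinned tuple (`rungA_liveRepin`).
[cite: Balaban1988Convergent, (3.22) p.269, (3.24) p.270; Balaban1989LargeFieldI, (0.3)–(0.4) p.176 (bookkeeping)] -/
theorem Stage12Params.exists_rungA_liveRepin (hθ : θ.Admissible F N) (hP : (θ.liveRepin F N).toStage9Params.Provisos₁₀) :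
    ∃ θ' : Stage9Params F N, θ'.Admissible ∧ θ'.Provisos₁₀ ∧ θ'.γ < 1 ∧ 0 < θ'.A₁ ∧
      ∀ θ₁ : Stage12Params F N, θ₁.toStage9Params = θ' → θ₁.SlotsNondegenerate :=
  ⟨_, Stage12Params.rungA_liveRepin F N θ hθ hP⟩

variable (ζ : ZetaOfRecord F N numerics7OfRecord₁₂ 1) (Rz : (K : ℕ) → Sect2.Residual (F.P K) (MatA N)) (Zt : (K : ℕ) → TkResidualW F N (FluctV N) K)

/-- **RUNG A AT `θ₀ˡⁱᵛᵉ = theta12LiveOfRecord F N ζ Rz Zt`, READ AT ITS STAGE-9 TUPLE, from `Provisos₁₀` there alone** (admissibility is hypothesis-free: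
`admissible_theta12OfRecord`; `γ = 1∕2`, `A₁ = 1`). [cite: Balaban1987RG1, (0.21) p.256, (1.16) p.262; Balaban1988Convergent, (3.4) p.265, (3.22) p.269, (3.24) p.270; Balaban1989LargeFieldI, (0.3)–(0.4) p.176 (bookkeeping)] -/
theorem rungA_theta12LiveOfRecord (hP : (theta12LiveOfRecord F N ζ Rz Zt).toStage9Params.Provisos₁₀) :
    (theta12LiveOfRecord F N ζ Rz Zt).toStage9Params.Admissible ∧ (theta12LiveOfRecord F N ζ Rz Zt).toStage9Params.Provisos₁₀ ∧
      (theta12LiveOfRecord F N ζ Rz Zt).toStage9Params.γ < 1 ∧ 0 < (theta12LiveOfRecord F N ζ Rz Zt).toStage9Params.A₁ ∧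
        ∀ θ₁ : Stage12Params F N, θ₁.toStage9Params = (theta12LiveOfRecord F N ζ Rz Zt).toStage9Params → θ₁.SlotsNondegenerate :=
  Stage12Params.rungA_liveRepin F N (theta12OfRecord F N ζ Rz Zt) (admissible_theta12OfRecord F N ζ Rz Zt) hP

/-- **RUNG A AT `θ₀ˡⁱᵛᵉ`, EXISTENTIAL FORM** (every `N`, every `ζ`, `Rz`, `Zt`). [cite: Balaban1988Convergent, (3.22) p.269, (3.24) p.270; Balaban1989LargeFieldI, (0.3)–(0.4) p.176 (bookkeeping)] -/
theorem exists_rungA_theta12LiveOfRecord (hP : (theta12LiveOfRecord F N ζ Rz Zt).toStage9Params.Provisos₁₀) :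
    ∃ θ' : Stage9Params F N, θ'.Admissible ∧ θ'.Provisos₁₀ ∧ θ'.γ < 1 ∧ 0 < θ'.A₁ ∧
      ∀ θ₁ : Stage12Params F N, θ₁.toStage9Params = θ' → θ₁.SlotsNondegenerate :=
  Stage12Params.exists_rungA_liveRepin F N (theta12OfRecord F N ζ Rz Zt) (admissible_theta12OfRecord F N ζ Rz Zt) hP

/-- **★ `Base12 F` ⟸ `Provisos₁₀ θ₀ˡⁱᵛᵉ`** (plan ANSWER №122, the first by-name landing on rung A of the skeleton of record v3): at `N = 2` and K0b's residuals of
record, the Stage-10 provisos of the re-pinned witness ALONE give the text of `K0Skeleton12.Base12 F` VERBATIM (`SlotsNondegenerateAt` unfolded) — so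
`stub_base12 F` is EXACTLY `Provisos₁₀` at `θ₀ˡⁱᵛᵉ`, whose located rows (H-U) ∕ P6 ∕ P7 seat K0c displays (`provisos₁₀_theta12LiveOfRecord_of_localBg`).  NOT a
discharge: `hP` is the open rung. [cite: Balaban1988Convergent, Thm 1 p.262, (3.22) p.269, (3.24) p.270; Balaban1989LargeFieldI, (0.3)–(0.4) p.176 (bookkeeping)] -/
theorem base12_theta12Live_of_provisos₁₀ (F : T4Family)
    (hP : (theta12LiveOfRecord F 2 (zeta316OfRecord F 2 numerics7OfRecord₁₂ 1 1) (RzOfRecord F 2) (ZtOfRecord F 2)).toStage9Params.Provisos₁₀) :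
    ∃ θ' : Stage9Params F 2, θ'.Admissible ∧ θ'.Provisos₁₀ ∧ θ'.γ < 1 ∧ 0 < θ'.A₁ ∧
      ∀ θ : Stage12Params F 2, θ.toStage9Params = θ' → θ.SlotsNondegenerate :=
  exists_rungA_theta12LiveOfRecord F 2 _ _ _ hP

end RungA

end Literature.MathematicalPhysics.QuantumFieldTheory.Balaban1983to89.Node00

end
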